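/-
Copyright (c) 2026 the pub-hodgecm-mathlib formalisation cell (harness21).  Prover seat hodgecm-mathlib-K2E3-p11 (g3), Track B «K2-LIT» ∕ h413,
line `K2_E3_EllipticInputs`, unit U12 «Characters», socket #11 `sig_K2E3CharLocIntNearSemisimple`, road (11-PS) «by class: principal series».
FILE 3 of the road: THE CHARACTER OF THE PRINCIPAL SERIES OF `U(Φ₃)(L⁺_v)` IS A LOCALLY INTEGRABLE FUNCTION.  2026-09-04.
-/
import Summits.HodgeConjecture.HodgeConjecture.Theorems.K2E3PrincipalSeriesCharPrelims     -- ★ (this seat) FILE 3a: `dgFormula_conj`, `dgFormula_coe_torus_eq_vanDijkWeight_re`, `classOrbitalIntegral_congr_class`, `density_wif_and_integrable`; brings ★ FILES 1–2, ★ PsmTransport, ★ HC-D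
import HarnessLib

/-!
# K2_E3 road (h413 = stmt-HodgeConjecture-24833), unit U12 «Characters», socket #11 — road (11-PS) «BY CLASS: PRINCIPAL SERIES», FILE 3:
# THE CHARACTER OF THE PRINCIPAL SERIES `i_G(χ)` OF `G = U(Φ₃)(L⁺_v)` (`v` NON-SPLIT) IS A LOCALLY INTEGRABLE FUNCTION `Θ_χ`, AND `Tr i_G(χ)(φ) = ∫_G φ Θ_χ` FOR EVERY
# `φ ∈ C_c^∞(G)` — van Dijk's theorem (Rogawski 1990 (4.9.4) p. 56, §12.5 p. 182; van Dijk 1972; Harish-Chandra 1970 Thm. 15 ∕ 1999 Thm. 16.1 for these classes)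

Cell `pub/hodgecm-mathlib` (D-0151), Track B (21-frontier RULING «PUSH BOTH» 2026-09-03), `--supports stmt-HodgeConjecture-24833 --as helper` (count-neutral);
THEOREMS ONLY — no `def`, no instance, no notation, no named fact, no `sorry`; ★-only imports.  Seat K2E3-p11 (g3), default self-deal (11-PS) (squad bus 00:51Z).

THE MATHEMATICS.  [Rogawski1990, §4.9 (4.9.4) p. 56, §12.5 p. 182; vanDijk1972, Thm. p. 237]: the character of `i_G(χ)` is the class function
`Θ_χ(x t x⁻¹) = (χ(t) + χ(ʷt)) ∕ D_G(t)` on the regular hyperbolic set `Ω = ⋃_x x T^{reg} x⁻¹` and `0` off `Ω`; it is locally integrable on `G` because `D_G⁻¹ = |D_G|^{−1∕2}` is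
[HarishChandra1970, Thm. 15], and it represents the trace on ALL of `C_c^∞(G)` (not only on functions supported in the regular set) — this is Harish-Chandra's Theorem 16.1 of
[HarishChandra1999] for the principal-series classes, i.e. the content of socket #11 `sig_K2E3CharLocIntNearSemisimple` for them.  EVERY analytic input is ★ in the tree:
(i) the van Dijk workhorse ★ `F0P3cStCharTSPsmTransport.smoothTrace_eq_inv_mul_integral_vanDijkWeight`: `Tr i_G(χ)(φ) = μ_T(T ∩ K_v)⁻¹ ∫_T χ·Δ·O^{can}(φ) dμ_T` for EVERY test
`φ`; (ii) the UNCONDITIONAL Weyl integration formula on `Ω` in density form `(Re Δ)²` (★ LH6 road «JAC-LOC», read for measurable test functions in ★ FILE 2); (iii) HC-D ★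
`F0P3cStCharTSWeylDiscrLocInt.locallyIntegrable_weylDiscr_inv` (`ϑ⁻¹ ∈ L¹_loc`, `ϑ = √√(‖disc χ_g‖·‖det g‖⁻²) = D_G`); (iv) ★ FILE 1 (the measurable class function `N_ψ` with torus
values `ψ = χ + χ∘ʷ`, bounded on compacts).  With `Θ_χ := (c₀∕c_T)·ϑ⁻¹·N_ψ` (`c₀ = (ι_*μM)(compactCore T)`, `c_T = (ι_*μM)(T ∩ K_v)`, any Haar `μM` on `M = E_vˣ × E¹_v`):
* §1 `dgFormula_coe_torus_eq_vanDijkWeight_re` (the junction `ϑ(t) = Re Δ(t)` on `T`, ★ VDW-CORE), `dgFormula_conj` (`ϑ` is a class function);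
* §2 `classOrbitalIntegral_congr_class` (orbital integrals at a class only read the function on that class);
* §3 **`exists_locallyIntegrable_smoothTrace_cmPrincipalSeries_eq`** — `∃ Θ ∈ L¹_loc(νQv), ∀ φ ∈ C_c^∞(G), Tr i_G(χ)(φ) = ∫ φ·Θ dνQv` (every continuous `χ : T →* ℂˣ`,
  every Haar `νQv`);
* §4 the ROW-11 SHAPE: **`charLocIntNearSemisimple_of_equiv_cmPrincipalSeries`** — socket #11's conclusion TOKEN FOR TOKEN (at `N = 3`, `H = Φ₃`, `v` non-split) for every class
  `c = ⟦r⟧` whose representative is EQUIVALENT to some `i_G(χ)` (in particular every IRREDUCIBLE principal series, e.g. ★ `isIrreducible_cmPrincipalSeries_of_cmWeylTorusCharPair_ne`).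
RESIDUE of row #11 at `N = 3`, `v` non-split, after this file: the supercuspidal classes (★ p856184's composition ⟸ (SC-lim∖ell)+(SC-dom)) and the constituents of the
REDUCIBLE `i_G(χ)` (the Steinberg-type ones follow by additivity from ★ finite-dimensional classes; `π²`, `π^±` need the l.d.s. identities or (11-Id)); inner forms and
other `H` reach `Φ₃` through ★ `K2E3CharLocIntNearSemisimpleModelTransport`.

HONEST LABEL: HC_CM is proved only modulo the 7 printed citations (2 remaining named inputs: hLiu418 = stmt-HodgeConjecture-24832, h413 = stmt-HodgeConjecture-24833)
until rung 0 closes; count-neutral helper: row #11 stays OPEN (this closes its (11-PS) road for the principal-series classes of `U(Φ₃)` at non-split places, unconditionally).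

## References
* [Rogawski1990] J. D. Rogawski, *Automorphic Representations of Unitary Groups in Three Variables*, Ann. of Math. Stud. 123 (1990), §4.9 Lemma 4.9.2, (4.9.4) p. 56; §12.5
  p. 182 (Weyl integration formula, `D_G`); §12.2 p. 173; §1.6 p. 6 («`χ_π(f) = ∫ f(g) χ_π(g) dg`»).
* [vanDijk1972] G. van Dijk, *Computation of certain induced characters of 𝔭-adic groups*, Math. Ann. 199 (1972), §2, Thm. p. 237.
* [HarishChandra1970] Harish-Chandra (notes by G. van Dijk), *Harmonic Analysis on Reductive p-adic Groups*, LNM 162 (1970), Part VII §1 Thm. 15 (`|D|^{−1∕2} ∈ L¹_loc`), Lemmas 22, 42.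
* [HarishChandra1999] Harish-Chandra (notes by S. DeBacker, P. J. Sally), *Admissible Invariant Distributions on Reductive p-adic Groups*, ULS 16 (1999), Thm. 16.1 p. 77.
-/

set_option autoImplicit false
-- the mandated namespace has the single-problem summit's repeated segment (`HodgeConjecture.HodgeConjecture`)
set_option linter.dupNamespace false

noncomputable section

open MeasureTheory Measure Set Filter Topology Function NumberField IsDedekindDomain Matrix Polynomial
open Literature.MeasureTheory.Group
open Literature.NumberTheory.Automorphic Literature.NumberTheory.Automorphic.UnitaryGroup Literature.NumberTheory.Rogawski1990
open Literature.NumberTheory.GaloisRepresentations Literature.NumberTheory.GaloisRepresentations.IsNonarchimedeanLocalField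
open Summit.HodgeConjecture.HodgeConjecture.Cruxes.H413
open Summit.HodgeConjecture.HodgeConjecture.Cruxes.H413.F0P3cStCharTSTorusDefs
open Summit.HodgeConjecture.HodgeConjecture.Cruxes.H413.F0P3cStCharTSTorusChartIso
open Summit.HodgeConjecture.HodgeConjecture.Cruxes.H413.F0P3cStCharTSWeylHypMeasure
open Summit.HodgeConjecture.HodgeConjecture.Cruxes.H413.F0P3cStCharTSWeylHypCM
open Summit.HodgeConjecture.HodgeConjecture.Cruxes.H413.F0P3cStCharTSWeylHypTorsor
open Summit.HodgeConjecture.HodgeConjecture.Cruxes.H413.F0P3cStCharTSWeylHypWIFJac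
open scoped ENNReal NNReal MatrixGroups ComplexConjugate
open Summit.HodgeConjecture.HodgeConjecture.Cruxes.H413.K2E3PrincipalSeriesCharPrelims

namespace Summit.HodgeConjecture.HodgeConjecture.Cruxes.H413.K2E3CharLocIntPrincipalSeriesThree

variable (L : Type) [Field L] [NumberField L] [IsCMField L] (v : HeightOneSpectrum (𝓞 ↥(maximalRealSubfield L)))

/-! ## §3 Weighted class functions `α_ψ = ϑ⁻¹ · N_ψ`: measurable, locally integrable, conjugation invariant, `= ψ ∕ Re Δ` on `T^{reg}` -/

/-- **THE WEIGHTED CLASS FUNCTION OF A `W`-SYMMETRIC TORUS FUNCTION.**  For `ψ : T → ℂ` continuous with `ψ(ʷt) = ψ(t)` there is `α : G → ℂ` (`G = U(Φ₃)(L⁺_v)`, `v` non-split)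
which is measurable, LOCALLY INTEGRABLE for every Haar measure (★ HC-D `locallyIntegrable_weylDiscr_inv`: `ϑ⁻¹ ∈ L¹_loc`, and `N_ψ` is bounded on compacts, ★ FILE 1),
conjugation invariant on `Ω`, zero off `Ω`, and equal to `(Re Δ(t))⁻¹ · ψ(t)` at every regular `t ∈ T` (§1 junction).  Witness: `α = ϑ⁻¹ · N_ψ`.
[cite: Rogawski1990, §12.5 p. 182; §4.9 (4.9.4) p. 56] [cite: HarishChandra1970, Part VII §1 Thm. 15; Lemma 42] -/
theorem exists_weightedClassFun (hns : ∀ w : PlacesOver L v, IsCMField.complexConj L • w.1 = w.1)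
    [MeasurableSpace (Gqs L v)] [BorelSpace (Gqs L v)] (νQv : Measure (Gqs L v)) [νQv.IsHaarMeasure]
    (w₀ : ↥(unitaryGroupOfForm (conjLocal L (IsCMField.complexConj L) v) (cmLocalForm L 3 v))) (hw₀ : Units.val (w₀ : GL (Fin 3) (LocalRing L v)) = cmLocalForm L 3 v)
    (ψ : ↥(cmBorelTriple L 3 v).M → ℂ) (hψ : Continuous ψ)
    (hψw : ∀ t : ↥(cmBorelTriple L 3 v).M, ψ ⟨w₀ * (t : ↥(unitaryGroupOfForm (conjLocal L (IsCMField.complexConj L) v) (cmLocalForm L 3 v))) * w₀⁻¹, weylConj_mem_cmTorus L v w₀ hw₀ t⟩ = ψ t) :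
    ∃ α : Gqs L v → ℂ, Measurable α ∧ LocallyIntegrable α νQv ∧
      (∀ x : Gqs L v, x ∈ hyperbolicSet L v → ∀ h : Gqs L v, α (h * x * h⁻¹) = α x) ∧
      (∀ x : Gqs L v, x ∉ hyperbolicSet L v → α x = 0) ∧
      (∀ t : ↥(cmBorelTriple L 3 v).M, IsRegularElt (((t : ↥(unitaryGroupOfForm (conjLocal L (IsCMField.complexConj L) v) (cmLocalForm L 3 v)))) : GL (Fin 3) (LocalRing L v)) →
        α (((t : ↥(unitaryGroupOfForm (conjLocal L (IsCMField.complexConj L) v) (cmLocalForm L 3 v)))) : Gqs L v) = ((((vanDijkWeight L v t).re)⁻¹ : ℝ) : ℂ) * ψ t) := by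
  -- the carrier's σ-algebra, read on the matrix spelling
  letI hmsU : MeasurableSpace ↥(unitaryGroupOfForm (conjLocal L (IsCMField.complexConj L) v) (cmLocalForm L 3 v)) := ‹MeasurableSpace (Gqs L v)›
  haveI : BorelSpace ↥(unitaryGroupOfForm (conjLocal L (IsCMField.complexConj L) v) (cmLocalForm L 3 v)) := ⟨BorelSpace.measurable_eq (α := Gqs L v)⟩
  haveI : LocallyCompactSpace (Gqs L v) := locallyCompactSpace_local (IsCMField.complexConj L) 3 _ v
  obtain ⟨N, hNm, hNinv, hN0, hNT, hNbd⟩ := K2E3HyperbolicClassFunOfTorus.exists_hyperbolicClassFun L v hns w₀ hw₀ ψ hψ hψw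
  have hϑc : Continuous fun g : Gqs L v => ((NNReal.sqrt (NNReal.sqrt ((∏ w : PlacesOver L v, normAbs (w.1.adicCompletion L) (((g.val : GL (Fin 3) (UnitaryGroup.LocalRing L v)).val.charpoly.discr) w)) * ((∏ w : PlacesOver L v, normAbs (w.1.adicCompletion L) (((g.val : GL (Fin 3) (UnitaryGroup.LocalRing L v)).val.det) w)) ^ 2)⁻¹)) : ℝ≥0) : ℝ) := F0P3cStCharTSDGField.continuous_dgFormula L v
  have hϑli : LocallyIntegrable (fun g : Gqs L v => (((NNReal.sqrt (NNReal.sqrt ((∏ w : PlacesOver L v, normAbs (w.1.adicCompletion L) (((g.val : GL (Fin 3) (UnitaryGroup.LocalRing L v)).val.charpoly.discr) w)) * ((∏ w : PlacesOver L v, normAbs (w.1.adicCompletion L) (((g.val : GL (Fin 3) (UnitaryGroup.LocalRing L v)).val.det) w)) ^ 2)⁻¹)) : ℝ≥0) : ℝ))⁻¹) νQv := F0P3cStCharTSWeylDiscrLocInt.locallyIntegrable_weylDiscr_inv L v hns νQv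
  refine ⟨fun g => (((((NNReal.sqrt (NNReal.sqrt ((∏ w : PlacesOver L v, normAbs (w.1.adicCompletion L) (((g.val : GL (Fin 3) (UnitaryGroup.LocalRing L v)).val.charpoly.discr) w)) * ((∏ w : PlacesOver L v, normAbs (w.1.adicCompletion L) (((g.val : GL (Fin 3) (UnitaryGroup.LocalRing L v)).val.det) w)) ^ 2)⁻¹)) : ℝ≥0) : ℝ))⁻¹ : ℝ) : ℂ) * N g, ?_, ?_, ?_, ?_, ?_⟩
  · exact (Complex.measurable_ofReal.comp hϑc.measurable.inv).mul hNm
  · rw [MeasureTheory.locallyIntegrable_iff]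
    intro K hK
    obtain ⟨B, hB⟩ := hNbd K hK
    have hmeas : AEStronglyMeasurable (fun g : Gqs L v => (((((NNReal.sqrt (NNReal.sqrt ((∏ w : PlacesOver L v, normAbs (w.1.adicCompletion L) (((g.val : GL (Fin 3) (UnitaryGroup.LocalRing L v)).val.charpoly.discr) w)) * ((∏ w : PlacesOver L v, normAbs (w.1.adicCompletion L) (((g.val : GL (Fin 3) (UnitaryGroup.LocalRing L v)).val.det) w)) ^ 2)⁻¹)) : ℝ≥0) : ℝ))⁻¹ : ℝ) : ℂ) * N g) (νQv.restrict K) :=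
      ((Complex.measurable_ofReal.comp hϑc.measurable.inv).mul hNm).aestronglyMeasurable
    refine Integrable.mono' (((hϑli.integrableOn_isCompact hK).norm).const_mul (max B 0)) hmeas ?_
    filter_upwards [ae_restrict_mem hK.measurableSet] with g hg
    rw [norm_mul, Complex.norm_real, mul_comm]
    exact mul_le_mul_of_nonneg_right ((hB g hg).trans (le_max_left _ _)) (norm_nonneg _)
  · intro x hx h
    show (((((NNReal.sqrt (NNReal.sqrt ((∏ w : PlacesOver L v, normAbs (w.1.adicCompletion L) ((((h * x * h⁻¹).val : GL (Fin 3) (UnitaryGroup.LocalRing L v)).val.charpoly.discr) w)) * ((∏ w : PlacesOver L v, normAbs (w.1.adicCompletion L) ((((h * x * h⁻¹).val : GL (Fin 3) (UnitaryGroup.LocalRing L v)).val.det) w)) ^ 2)⁻¹)) : ℝ≥0) : ℝ))⁻¹ : ℝ) : ℂ) * N (h * x * h⁻¹) = (((((NNReal.sqrt (NNReal.sqrt ((∏ w : PlacesOver L v, normAbs (w.1.adicCompletion L) (((x.val : GL (Fin 3) (UnitaryGroup.LocalRing L v)).val.charpoly.discr) w)) * ((∏ w : PlacesOver L v, normAbs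 (w.1.adicCompletion L) (((x.val : GL (Fin 3) (UnitaryGroup.LocalRing L v)).val.det) w)) ^ 2)⁻¹)) : ℝ≥0) : ℝ))⁻¹ : ℝ) : ℂ) * N x
    rw [dgFormula_conj L v x h]
    exact congrArg _ (hNinv x hx h)
  · intro x hx
    show (((((NNReal.sqrt (NNReal.sqrt ((∏ w : PlacesOver L v, normAbs (w.1.adicCompletion L) (((x.val : GL (Fin 3) (UnitaryGroup.LocalRing L v)).val.charpoly.discr) w)) * ((∏ w : PlacesOver L v, normAbs (w.1.adicCompletion L) (((x.val : GL (Fin 3) (UnitaryGroup.LocalRing L v)).val.det) w)) ^ 2)⁻¹)) : ℝ≥0) : ℝ))⁻¹ : ℝ) : ℂ) * N x = 0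
    rw [hN0 x hx, mul_zero]
  · intro t ht
    show (((((NNReal.sqrt (NNReal.sqrt ((∏ w : PlacesOver L v, normAbs (w.1.adicCompletion L) ((((((t : ↥(unitaryGroupOfForm (conjLocal L (IsCMField.complexConj L) v) (cmLocalForm L 3 v)))) : Gqs L v).val : GL (Fin 3) (UnitaryGroup.LocalRing L v)).val.charpoly.discr) w)) * ((∏ w : PlacesOver L v, normAbs (w.1.adicCompletion L) ((((((t : ↥(unitaryGroupOfForm (conjLocal L (IsCMField.complexConj L) v) (cmLocalForm L 3 v)))) : Gqs L v).val : GL (Fin 3) (UnitaryGroup.LocalRing L v)).val.det) w)) ^ 2)⁻¹)) : ℝ≥0) : ℝ))⁻¹ : ℝ) : ℂ) * N (t : ↥(unitaryGroupOfForm (conjLocal L (IsCMField.complexConj L) v) (cmLocalForm L 3 v))) = _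
    rw [dgFormula_coe_torus_eq_vanDijkWeight_re L v hns t, hNT t ht]


/-! ## §4 The character of `i_G(χ)` is a locally integrable function representing the trace on all of `C_c^∞(G)` -/

set_option maxHeartbeats 3200000 in
-- a long assembly over the (TOR) road's ★ theorems (the van Dijk workhorse, the density WIF, HC-D); the budget is for the many `integral_congr_ae` steps
/-- **THE CHARACTER OF THE PRINCIPAL SERIES IS A LOCALLY INTEGRABLE FUNCTION.**  `G = U(Φ₃)(L⁺_v)` (`Gqs L v`), `v` NON-SPLIT, `νQv` any Haar measure, `χ : T →* ℂˣ`
continuous.  There is `Θ : G → ℂ`, LOCALLY INTEGRABLE, with **`Tr i_G(χ)(φ) = ∫_G φ·Θ dνQv` for EVERY locally constant compactly supported `φ`** — van Dijk's theorem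
`Θ = (χ + χ∘ʷ)∕D_G` on the regular hyperbolic set, `0` off it [Rogawski1990 (4.9.4), §12.5], i.e. Harish-Chandra's Theorem 16.1 for the classes `i_G(χ)`.
Witness: `Θ = (c₀∕c_T)·ϑ⁻¹·N_{χ+χ∘ʷ}` (§3).  PROOF: ★ workhorse (torus form, pulled back to `M`, `W`-symmetrised by the `μM`-preserving reflection — the symmetrisation
needs the integrability of the torus-side integrand, which is dominated through ★ FILE 2's integrability by the weighted class function of `‖χ‖ + ‖χ∘ʷ‖`), ★ FILE 2
(density WIF for `𝟙_Ω·φ`; the orbital integrals of `𝟙_Ω·φ` and `φ` agree at regular torus classes, §2), and the pointwise identity `(Re Δ)²·ϑ⁻¹ = Δ` on `T^{reg}` (§1).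
[cite: Rogawski1990, §4.9 (4.9.4) p. 56; §12.5 p. 182; §1.6 p. 6] [cite: vanDijk1972, Thm. p. 237] [cite: HarishChandra1970, Part VII §1 Thm. 15; Lemma 42]
[cite: HarishChandra1999, Thm. 16.1 p. 77] -/
theorem exists_locallyIntegrable_smoothTrace_cmPrincipalSeries_eq
    (hns : ∀ w : PlacesOver L v, IsCMField.complexConj L • w.1 = w.1)
    [MeasurableSpace (Gqs L v)] [BorelSpace (Gqs L v)] (νQv : Measure (Gqs L v)) [νQv.IsHaarMeasure]
    (χ : ↥(cmBorelTriple L 3 v).M →* ℂˣ) (hχ : Continuous fun t => ((χ t : ℂˣ) : ℂ)) :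
    ∃ Θ : Gqs L v → ℂ, LocallyIntegrable Θ νQv ∧
      ∀ φ : Gqs L v → ℂ, IsLocallyConstant φ → HasCompactSupport φ →
        Representation.smoothTrace (G := Gqs L v) (UnitaryGroup.cmPrincipalSeries L 3 v χ) νQv φ = ∫ g, φ g * Θ g ∂νQv := by
  classical
  -- §a instances on the two spellings of the carrier, on the quotients, on the parameter torus
  letI hmsU : MeasurableSpace ↥(unitaryGroupOfForm (conjLocal L (IsCMField.complexConj L) v) (cmLocalForm L 3 v)) := ‹MeasurableSpace (Gqs L v)›
  haveI hbU : BorelSpace ↥(unitaryGroupOfForm (conjLocal L (IsCMField.complexConj L) v) (cmLocalForm L 3 v)) := ⟨BorelSpace.measurable_eq (α := Gqs L v)⟩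
  haveI : LocallyCompactSpace ↥(unitaryGroupOfForm (conjLocal L (IsCMField.complexConj L) v) (cmLocalForm L 3 v)) := locallyCompactSpace_local (IsCMField.complexConj L) 3 _ v
  haveI : SecondCountableTopology ↥(unitaryGroupOfForm (conjLocal L (IsCMField.complexConj L) v) (cmLocalForm L 3 v)) := secondCountableTopology_local (IsCMField.complexConj L) 3 _ v
  haveI : T2Space ↥(unitaryGroupOfForm (conjLocal L (IsCMField.complexConj L) v) (cmLocalForm L 3 v)) := t2Space_cmDatum_local 3 L (Matrix.of fun i j : Fin 3 => if i.val + j.val + 1 = 3 then (1 : L) else 0) v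
  letI hq : ∀ γ : Gqs L v, MeasurableSpace (Gqs L v ⧸ Subgroup.centralizer ({γ} : Set (Gqs L v))) := fun γ => borel _
  haveI hqb : ∀ γ : Gqs L v, BorelSpace (Gqs L v ⧸ Subgroup.centralizer ({γ} : Set (Gqs L v))) := fun γ => ⟨rfl⟩
  haveI hνr : νQv.IsMulRightInvariant :=
    isMulRightInvariant_cmDatum_local_three L (qsForm L) (antidiagOne_isHermitian L 3) (isUnit_antidiagOne_det L 3).ne_zero v νQv
  letI : MeasurableSpace ((LocalRing L v)ˣ × ↥(normOneUnits (conjLocal L (IsCMField.complexConj L) v))) := borel _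
  haveI : BorelSpace ((LocalRing L v)ˣ × ↥(normOneUnits (conjLocal L (IsCMField.complexConj L) v))) := ⟨rfl⟩
  haveI := F0P3cStCharTSTorusRay.locallyCompactSpace_torus L v
  haveI := F0P3cStCharTSTorusRay.secondCountableTopology_torus L v
  obtain ⟨μM, hμM⟩ : ∃ μM : Measure ((LocalRing L v)ˣ × ↥(normOneUnits (conjLocal L (IsCMField.complexConj L) v))), μM.IsHaarMeasure := ⟨Measure.haar, inferInstance⟩
  haveI hμT : (μM.map (torusChart L v)).IsHaarMeasure := isHaarMeasure_map_torusChart L v μM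
  -- the two constants of the torus measure `ι_* μM`
  obtain ⟨hcoreC, hcoreO⟩ := isCompact_isOpen_compactCore_cmTorus L v
  obtain ⟨c₀, hc₀⟩ : ∃ c : ℝ≥0∞, c = μM ((torusChart L v) ⁻¹' compactCore ↥(cmBorelTriple L 3 v).M) := ⟨_, rfl⟩
  have hmap : (μM.map (torusChart L v)) (compactCore ↥(cmBorelTriple L 3 v).M) = μM ((torusChart L v) ⁻¹' compactCore ↥(cmBorelTriple L 3 v).M) :=
    Measure.map_apply (continuous_torusChart L v).measurable hcoreC.isClosed.measurableSet
  have hc0 : c₀ ≠ 0 := by rw [hc₀, ← hmap]; exact (hcoreO.measure_pos _ ⟨1, one_mem_compactCore⟩).ne'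
  have hctop : c₀ ≠ ∞ := by rw [hc₀, ← hmap]; exact hcoreC.measure_lt_top.ne
  have hc₀r : c₀.toReal ≠ 0 := ENNReal.toReal_ne_zero.2 ⟨hc0, hctop⟩
  obtain ⟨cT, hcT⟩ : ∃ c : ℝ, c = (μM.map (torusChart L v)).real {t : ↥(cmBorelTriple L 3 v).M | (t : ↥(unitaryGroupOfForm (conjLocal L (IsCMField.complexConj L) v) (cmLocalForm L 3 v))) ∈ cmLocalIntegralLevel L 3 (Matrix.of fun i j : Fin 3 => if i.val + j.val + 1 = 3 then (1 : L) else 0) v} := ⟨_, rfl⟩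
  -- canonical orbital measures; the Weyl element; the reflected torus point
  obtain ⟨mQv, hcanQ⟩ := exists_isCanonical_cmDatum_local L (qsForm L) (antidiagOne_isHermitian L 3) (isUnit_antidiagOne_det L 3) v νQv
  obtain ⟨w₀, hw₀'⟩ := exists_coe_eq_antidiagonal L (IsCMField.complexConj L) 3 v (cmLocalForm_eq_over L 3 v)
  have hw₀ : Units.val (w₀ : GL (Fin 3) (LocalRing L v)) = cmLocalForm L 3 v := by rw [hw₀', cmLocalForm_eq_over]
  have hwc : Continuous fun t : ↥(cmBorelTriple L 3 v).M => (⟨w₀ * ((t) : ↥(unitaryGroupOfForm (conjLocal L (IsCMField.complexConj L) v) (cmLocalForm L 3 v))) * w₀⁻¹, weylConj_mem_cmTorus L v w₀ hw₀ (t)⟩ : ↥(cmBorelTriple L 3 v).M) :=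
    ((continuous_const.mul continuous_subtype_val).mul continuous_const).subtype_mk _
  have hww : ∀ t : ↥(cmBorelTriple L 3 v).M, (⟨w₀ * (((⟨w₀ * ((t) : ↥(unitaryGroupOfForm (conjLocal L (IsCMField.complexConj L) v) (cmLocalForm L 3 v))) * w₀⁻¹, weylConj_mem_cmTorus L v w₀ hw₀ (t)⟩ : ↥(cmBorelTriple L 3 v).M)) : ↥(unitaryGroupOfForm (conjLocal L (IsCMField.complexConj L) v) (cmLocalForm L 3 v))) * w₀⁻¹, weylConj_mem_cmTorus L v w₀ hw₀ ((⟨w₀ * ((t) : ↥(unitaryGroupOfForm (conjLocal L (IsCMField.complexConj L) v) (cmLocalForm L 3 v))) * w₀⁻¹, weylConj_mem_cmTorus L v w₀ hw₀ (t)⟩ : ↥(cmBorelTriple L 3 v).M))⟩ : ↥(cmBorelTriple L 3 v).M) = t :=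
    fun t => Subtype.ext (K2E3HyperbolicClassFunOfTorus.weylConj_weylConj_eq L v w₀ hw₀ t.2)
  -- §b the torus functions `ψ = χ + χ ∘ ʷ`, `ψ₂ = ‖χ‖ + ‖χ ∘ ʷ‖` and their weighted class functions (§3)
  obtain ⟨ψ, hψ⟩ : ∃ ψ : ↥(cmBorelTriple L 3 v).M → ℂ, ∀ t, ψ t = ((χ t : ℂˣ) : ℂ) + ((χ (⟨w₀ * ((t) : ↥(unitaryGroupOfForm (conjLocal L (IsCMField.complexConj L) v) (cmLocalForm L 3 v))) * w₀⁻¹, weylConj_mem_cmTorus L v w₀ hw₀ (t)⟩ : ↥(cmBorelTriple L 3 v).M) : ℂˣ) : ℂ) := ⟨fun t => _, fun t => rfl⟩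
  obtain ⟨ψ₂, hψ₂⟩ : ∃ ψ₂ : ↥(cmBorelTriple L 3 v).M → ℂ, ∀ t, ψ₂ t = (((‖((χ t : ℂˣ) : ℂ)‖ + ‖((χ (⟨w₀ * ((t) : ↥(unitaryGroupOfForm (conjLocal L (IsCMField.complexConj L) v) (cmLocalForm L 3 v))) * w₀⁻¹, weylConj_mem_cmTorus L v w₀ hw₀ (t)⟩ : ↥(cmBorelTriple L 3 v).M) : ℂˣ) : ℂ)‖ : ℝ)) : ℂ) := ⟨fun t => _, fun t => rfl⟩
  have hψc : Continuous ψ := by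
    have : ψ = fun t => ((χ t : ℂˣ) : ℂ) + ((χ (⟨w₀ * ((t) : ↥(unitaryGroupOfForm (conjLocal L (IsCMField.complexConj L) v) (cmLocalForm L 3 v))) * w₀⁻¹, weylConj_mem_cmTorus L v w₀ hw₀ (t)⟩ : ↥(cmBorelTriple L 3 v).M) : ℂˣ) : ℂ) := funext hψ
    rw [this]; exact hχ.add (hχ.comp hwc)
  have hψ₂c : Continuous ψ₂ := by
    have : ψ₂ = fun t => (((‖((χ t : ℂˣ) : ℂ)‖ + ‖((χ (⟨w₀ * ((t) : ↥(unitaryGroupOfForm (conjLocal L (IsCMField.complexConj L) v) (cmLocalForm L 3 v))) * w₀⁻¹, weylConj_mem_cmTorus L v w₀ hw₀ (t)⟩ : ↥(cmBorelTriple L 3 v).M) : ℂˣ) : ℂ)‖ : ℝ)) : ℂ) := funext hψ₂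
    rw [this]; exact Complex.continuous_ofReal.comp ((continuous_norm.comp hχ).add (continuous_norm.comp (hχ.comp hwc)))
  have hψw : ∀ t : ↥(cmBorelTriple L 3 v).M, ψ (⟨w₀ * ((t) : ↥(unitaryGroupOfForm (conjLocal L (IsCMField.complexConj L) v) (cmLocalForm L 3 v))) * w₀⁻¹, weylConj_mem_cmTorus L v w₀ hw₀ (t)⟩ : ↥(cmBorelTriple L 3 v).M) = ψ t := fun t => by rw [hψ, hψ, hww, add_comm]
  have hψ₂w : ∀ t : ↥(cmBorelTriple L 3 v).M, ψ₂ (⟨w₀ * ((t) : ↥(unitaryGroupOfForm (conjLocal L (IsCMField.complexConj L) v) (cmLocalForm L 3 v))) * w₀⁻¹, weylConj_mem_cmTorus L v w₀ hw₀ (t)⟩ : ↥(cmBorelTriple L 3 v).M) = ψ₂ t := fun t => by rw [hψ₂, hψ₂, hww, add_comm]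
  obtain ⟨α, hαm, hαli, hαinv, hα0, hαT⟩ := exists_weightedClassFun L v hns νQv w₀ hw₀ ψ hψc hψw
  obtain ⟨α₂, hα₂m, hα₂li, hα₂inv, -, hα₂T⟩ := exists_weightedClassFun L v hns νQv w₀ hw₀ ψ₂ hψ₂c hψ₂w
  -- §c the witness `Θ = (c₀ ∕ c_T) · α`
  refine ⟨fun g => ((c₀.toReal * cT⁻¹ : ℝ) : ℂ) * α g, ?_, fun φ hφ hφc => ?_⟩
  · have h := hαli.smul ((c₀.toReal * cT⁻¹ : ℝ) : ℂ)
    simpa only [Pi.smul_def, smul_eq_mul] using h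
  -- §d the identity
  -- (1) van Dijk's workhorse in torus form for `μ_T = ι_* μM`, pulled back to `M`
  have h1 := F0P3cStCharTSPsmTransport.smoothTrace_eq_inv_mul_integral_vanDijkWeight L v hns νQv mQv hcanQ χ hχ φ hφ hφc
    (μM.map (torusChart L v))
  rw [← hcT, integral_comp_torusChart] at h1
  -- (2) the reflection `ω` of `M`: `Δ` and the orbital integrals are `ω`-invariant, so is the torus-side integral
  have hG : ∀ m : ((LocalRing L v)ˣ × ↥(normOneUnits (conjLocal L (IsCMField.complexConj L) v))),
      vanDijkWeight L v (torusChart L v ((Units.map ((conjLocal L (IsCMField.complexConj L) v : LocalRing L v →+* LocalRing L v) : LocalRing L v →* LocalRing L v) m.1)⁻¹, m.2)) * classOrbitalIntegral mQv φ (ConjClasses.mk ((((torusChart L v ((Units.map ((conjLocal L (IsCMField.complexConj L) v : LocalRing L v →+* LocalRing L v) : LocalRing L v →* LocalRing L v) m.1)⁻¹, m.2)) : ↥(cmBorelTriple L 3 v).M) : ↥(unitaryGroupOfForm (conjLocal L (IsCMField.complexConj L) v) (cmLocalForm L 3 v))) : Gqs L v)) =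
        vanDijkWeight L v (torusChart L v m) * classOrbitalIntegral mQv φ (ConjClasses.mk ((((torusChart L v m) : ↥(cmBorelTriple L 3 v).M) : ↥(unitaryGroupOfForm (conjLocal L (IsCMField.complexConj L) v) (cmLocalForm L 3 v))) : Gqs L v)) := by
    intro m
    rw [F0P3cStCharTSPsmTransport.torusChart_reflect L v w₀ hw₀ m,
      F0P3cStCharTSVanDijkWeylSymm.vanDijkWeight_weylConj L v w₀ hw₀ (torusChart L v m) (⟨w₀ * ((torusChart L v m) : ↥(unitaryGroupOfForm (conjLocal L (IsCMField.complexConj L) v) (cmLocalForm L 3 v))) * w₀⁻¹, weylConj_mem_cmTorus L v w₀ hw₀ (torusChart L v m)⟩ : ↥(cmBorelTriple L 3 v).M) rfl]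
    congr 2
    refine ConjClasses.mk_eq_mk_iff_isConj.2 (isConj_iff.2 ⟨((w₀⁻¹ : ↥(unitaryGroupOfForm (conjLocal L (IsCMField.complexConj L) v) (cmLocalForm L 3 v))) : Gqs L v), ?_⟩)
    show ((w₀⁻¹ * (w₀ * ((torusChart L v m : ↥(cmBorelTriple L 3 v).M) : ↥(unitaryGroupOfForm (conjLocal L (IsCMField.complexConj L) v) (cmLocalForm L 3 v))) * w₀⁻¹) * w₀⁻¹⁻¹ : ↥(unitaryGroupOfForm (conjLocal L (IsCMField.complexConj L) v) (cmLocalForm L 3 v))) : Gqs L v) = ((((torusChart L v m) : ↥(cmBorelTriple L 3 v).M) : ↥(unitaryGroupOfForm (conjLocal L (IsCMField.complexConj L) v) (cmLocalForm L 3 v))) : Gqs L v)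
    group
  have hχω : ∀ m : ((LocalRing L v)ˣ × ↥(normOneUnits (conjLocal L (IsCMField.complexConj L) v))), ((χ (⟨w₀ * ((torusChart L v m) : ↥(unitaryGroupOfForm (conjLocal L (IsCMField.complexConj L) v) (cmLocalForm L 3 v))) * w₀⁻¹, weylConj_mem_cmTorus L v w₀ hw₀ (torusChart L v m)⟩ : ↥(cmBorelTriple L 3 v).M) : ℂˣ) : ℂ) = (((χ (torusChart L v ((Units.map ((conjLocal L (IsCMField.complexConj L) v : LocalRing L v →+* LocalRing L v) : LocalRing L v →* LocalRing L v) m.1)⁻¹, m.2))) : ℂˣ) : ℂ) := by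
    intro m; rw [F0P3cStCharTSPsmTransport.torusChart_reflect L v w₀ hw₀ m]
  -- (3) the density WIF (★ FILE 2) for `𝟙_Ω φ` against `α`, and the integrability of the density-side integrands against `α₂` and `1`
  have hΩo : IsOpen (X := ↥(unitaryGroupOfForm (conjLocal L (IsCMField.complexConj L) v) (cmLocalForm L 3 v))) (hyperbolicSet L v) := K2E3HyperbolicClassFunOfTorus.isOpen_hyperbolicSet L v hns
  have hΩm : MeasurableSet (hyperbolicSet L v : Set ↥(unitaryGroupOfForm (conjLocal L (IsCMField.complexConj L) v) (cmLocalForm L 3 v))) := hΩo.measurableSet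
  obtain ⟨φ', hφ'⟩ : ∃ φ' : Gqs L v → ℂ, φ' = (hyperbolicSet L v).indicator φ := ⟨_, rfl⟩
  have hφ'm : Measurable φ' := by rw [hφ']; exact hφ.continuous.measurable.indicator hΩm
  have hφ'0 : ∀ x : Gqs L v, x ∉ hyperbolicSet L v → φ' x = 0 := fun x hx => by rw [hφ']; exact Set.indicator_of_notMem hx _
  have hφ'Ω : ∀ x : Gqs L v, x ∈ hyperbolicSet L v → φ' x = φ x := fun x hx => by rw [hφ']; exact Set.indicator_of_mem hx _
  have hφα : Integrable (fun x => φ x * α x) νQv := by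
    have h := hαli.integrable_smul_left_of_hasCompactSupport hφ.continuous hφc
    simpa only [smul_eq_mul] using h
  have hφα₂ : Integrable (fun x => φ x * α₂ x) νQv := by
    have h := hα₂li.integrable_smul_left_of_hasCompactSupport hφ.continuous hφc
    simpa only [smul_eq_mul] using h
  have hφ1 : Integrable (fun x => φ x * (1 : ℂ)) νQv := by
    simpa only [mul_one] using hφ.continuous.integrable_of_hasCompactSupport hφc
  have hint : ∀ β : Gqs L v → ℂ, Integrable (fun x => φ x * β x) νQv →
      IntegrableOn (fun x => φ' x * β x) (hyperbolicSet L v) νQv := fun β hβ =>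
    hβ.integrableOn.congr_fun (fun x hx => by simp only [hφ'Ω x hx]) hΩm
  obtain ⟨hW, -⟩ := density_wif_and_integrable L v hns νQv hcanQ μM w₀ hw₀ φ' α hφ'm hαm hαinv (hint α hφα) hφ'0
  obtain ⟨-, hI₂⟩ := density_wif_and_integrable L v hns νQv hcanQ μM w₀ hw₀ φ' α₂ hφ'm hα₂m hα₂inv (hint α₂ hφα₂) hφ'0
  obtain ⟨-, hI₁⟩ := density_wif_and_integrable L v hns νQv hcanQ μM w₀ hw₀ φ' (fun _ => (1 : ℂ)) hφ'm measurable_const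
    (fun _ _ _ => rfl) (hint (fun _ => (1 : ℂ)) hφ1) hφ'0
  rw [← hc₀] at hW hI₂ hI₁
  -- (4) almost every parameter is regular: the density is positive there and the two test functions have the same orbital integrals
  have hreg : ∀ᵐ m ∂μM, IsRegularElt (((((torusChart L v m) : ↥(cmBorelTriple L 3 v).M) : ↥(unitaryGroupOfForm (conjLocal L (IsCMField.complexConj L) v) (cmLocalForm L 3 v)))) : GL (Fin 3) (LocalRing L v)) ∧ 0 < (vanDijkWeight L v (torusChart L v m)).re := by
    refine ae_of_ae_map (p := fun t : ↥(cmBorelTriple L 3 v).M =>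
      IsRegularElt (((t : ↥(unitaryGroupOfForm (conjLocal L (IsCMField.complexConj L) v) (cmLocalForm L 3 v)))) : GL (Fin 3) (LocalRing L v)) ∧
        0 < (vanDijkWeight L v t).re) (continuous_torusChart L v).measurable.aemeasurable ?_
    filter_upwards [ae_isRegularElt_cmTorus L v (μM.map (torusChart L v)), ae_isUnit_torusEntry_sub_three L v (μM.map (torusChart L v))]
      with t ht hu using ⟨ht, (F0P3cStCharTSVanDijkCore.vanDijkWeight_re_pos_iff L v hns t).2 ⟨hu.2.1, hu.2.2⟩⟩
  have hO' : ∀ m : ((LocalRing L v)ˣ × ↥(normOneUnits (conjLocal L (IsCMField.complexConj L) v))), IsRegularElt (((((torusChart L v m) : ↥(cmBorelTriple L 3 v).M) : ↥(unitaryGroupOfForm (conjLocal L (IsCMField.complexConj L) v) (cmLocalForm L 3 v)))) : GL (Fin 3) (LocalRing L v)) →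
      classOrbitalIntegral mQv φ' (ConjClasses.mk ((((torusChart L v m) : ↥(cmBorelTriple L 3 v).M) : ↥(unitaryGroupOfForm (conjLocal L (IsCMField.complexConj L) v) (cmLocalForm L 3 v))) : Gqs L v)) = classOrbitalIntegral mQv φ (ConjClasses.mk ((((torusChart L v m) : ↥(cmBorelTriple L 3 v).M) : ↥(unitaryGroupOfForm (conjLocal L (IsCMField.complexConj L) v) (cmLocalForm L 3 v))) : Gqs L v)) := by
    intro m hm
    refine classOrbitalIntegral_congr_class mQv _ (fun y hy => hφ'Ω y ?_)
    exact ⟨torusChart L v m, hm, (ConjClasses.mk_eq_mk_iff_isConj.1 hy).symm⟩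
  -- (5) pointwise bookkeeping at a regular parameter: the norms and the value of the density-side integrand
  have hc : 0 < c₀.toReal := ENNReal.toReal_pos hc0 hctop
  have hρval : ∀ m : ((LocalRing L v)ˣ × ↥(normOneUnits (conjLocal L (IsCMField.complexConj L) v))), IsRegularElt (((((torusChart L v m) : ↥(cmBorelTriple L 3 v).M) : ↥(unitaryGroupOfForm (conjLocal L (IsCMField.complexConj L) v) (cmLocalForm L 3 v)))) : GL (Fin 3) (LocalRing L v)) → 0 < (vanDijkWeight L v (torusChart L v m)).re →
      classOrbitalIntegral mQv φ' (ConjClasses.mk ((((torusChart L v m) : ↥(cmBorelTriple L 3 v).M) : ↥(unitaryGroupOfForm (conjLocal L (IsCMField.complexConj L) v) (cmLocalForm L 3 v))) : Gqs L v)) * ((((2 * c₀.toReal)⁻¹ * ((vanDijkWeight L v (torusChart L v m)).re ^ 2 : ℝ) : ℝ) : ℂ) * α ((((torusChart L v m) : ↥(cmBorelTriple L 3 v).M) : ↥(unitaryGroupOfForm (conjLocal L (IsCMField.complexConj L) v) (cmLocalForm L 3 v))) : Gqs L v)) =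
        (((2 * c₀.toReal)⁻¹ : ℝ) : ℂ) * (ψ (torusChart L v m) * (vanDijkWeight L v (torusChart L v m) * classOrbitalIntegral mQv φ (ConjClasses.mk ((((torusChart L v m) : ↥(cmBorelTriple L 3 v).M) : ↥(unitaryGroupOfForm (conjLocal L (IsCMField.complexConj L) v) (cmLocalForm L 3 v))) : Gqs L v)))) := by
    intro m hmreg hpos
    have hΔ : vanDijkWeight L v (torusChart L v m) = (((vanDijkWeight L v (torusChart L v m)).re : ℝ) : ℂ) := (F0P3cStCharTSVanDijkCore.ofReal_vanDijkWeight_re L v hns _).symm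
    rw [hO' m hmreg, hαT _ hmreg]
    generalize hr : (vanDijkWeight L v (torusChart L v m)).re = r at hpos ⊢
    rw [show vanDijkWeight L v (torusChart L v m) = ((r : ℝ) : ℂ) by rw [hΔ, hr]]
    have hr0 : (r : ℂ) ≠ 0 := Complex.ofReal_ne_zero.2 hpos.ne'
    push_cast
    field_simp
  have hnormS : ∀ m : ((LocalRing L v)ˣ × ↥(normOneUnits (conjLocal L (IsCMField.complexConj L) v))), IsRegularElt (((((torusChart L v m) : ↥(cmBorelTriple L 3 v).M) : ↥(unitaryGroupOfForm (conjLocal L (IsCMField.complexConj L) v) (cmLocalForm L 3 v)))) : GL (Fin 3) (LocalRing L v)) → 0 < (vanDijkWeight L v (torusChart L v m)).re →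
      ‖(((χ (torusChart L v m)) : ℂˣ) : ℂ) * (vanDijkWeight L v (torusChart L v m) * classOrbitalIntegral mQv φ (ConjClasses.mk ((((torusChart L v m) : ↥(cmBorelTriple L 3 v).M) : ↥(unitaryGroupOfForm (conjLocal L (IsCMField.complexConj L) v) (cmLocalForm L 3 v))) : Gqs L v)))‖ ≤
        2 * c₀.toReal * ‖classOrbitalIntegral mQv φ' (ConjClasses.mk ((((torusChart L v m) : ↥(cmBorelTriple L 3 v).M) : ↥(unitaryGroupOfForm (conjLocal L (IsCMField.complexConj L) v) (cmLocalForm L 3 v))) : Gqs L v)) * ((((2 * c₀.toReal)⁻¹ * ((vanDijkWeight L v (torusChart L v m)).re ^ 2 : ℝ) : ℝ) : ℂ) * α₂ ((((torusChart L v m) : ↥(cmBorelTriple L 3 v).M) : ↥(unitaryGroupOfForm (conjLocal L (IsCMField.complexConj L) v) (cmLocalForm L 3 v))) : Gqs L v))‖ := by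
    intro m hmreg hpos
    have hΔ : vanDijkWeight L v (torusChart L v m) = (((vanDijkWeight L v (torusChart L v m)).re : ℝ) : ℂ) := (F0P3cStCharTSVanDijkCore.ofReal_vanDijkWeight_re L v hns _).symm
    rw [hO' m hmreg, hα₂T _ hmreg, hψ₂]
    generalize hr : (vanDijkWeight L v (torusChart L v m)).re = r at hpos hΔ ⊢
    rw [hΔ]
    have ha : 0 ≤ ‖(((χ (torusChart L v m)) : ℂˣ) : ℂ)‖ := norm_nonneg _
    have hb : 0 ≤ ‖((χ (⟨w₀ * ((torusChart L v m) : ↥(unitaryGroupOfForm (conjLocal L (IsCMField.complexConj L) v) (cmLocalForm L 3 v))) * w₀⁻¹, weylConj_mem_cmTorus L v w₀ hw₀ (torusChart L v m)⟩ : ↥(cmBorelTriple L 3 v).M) : ℂˣ) : ℂ)‖ := norm_nonneg _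
    have hq : 0 ≤ ‖classOrbitalIntegral mQv φ (ConjClasses.mk ((((torusChart L v m) : ↥(cmBorelTriple L 3 v).M) : ↥(unitaryGroupOfForm (conjLocal L (IsCMField.complexConj L) v) (cmLocalForm L 3 v))) : Gqs L v))‖ := norm_nonneg _
    have hc' : c₀.toReal ≠ 0 := hc.ne'
    have hr0 : r ≠ 0 := hpos.ne'
    have h1 : (0 : ℝ) ≤ (2 * c₀.toReal)⁻¹ * r ^ 2 := by positivity
    have h2 : (0 : ℝ) ≤ r⁻¹ := inv_nonneg.2 hpos.le
    have h3 : (0 : ℝ) ≤ ‖(((χ (torusChart L v m)) : ℂˣ) : ℂ)‖ + ‖((χ (⟨w₀ * ((torusChart L v m) : ↥(unitaryGroupOfForm (conjLocal L (IsCMField.complexConj L) v) (cmLocalForm L 3 v))) * w₀⁻¹, weylConj_mem_cmTorus L v w₀ hw₀ (torusChart L v m)⟩ : ↥(cmBorelTriple L 3 v).M) : ℂˣ) : ℂ)‖ := by positivity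
    have key : ‖(((χ (torusChart L v m)) : ℂˣ) : ℂ)‖ * (r * ‖classOrbitalIntegral mQv φ (ConjClasses.mk ((((torusChart L v m) : ↥(cmBorelTriple L 3 v).M) : ↥(unitaryGroupOfForm (conjLocal L (IsCMField.complexConj L) v) (cmLocalForm L 3 v))) : Gqs L v))‖) ≤ (‖(((χ (torusChart L v m)) : ℂˣ) : ℂ)‖ + ‖((χ (⟨w₀ * ((torusChart L v m) : ↥(unitaryGroupOfForm (conjLocal L (IsCMField.complexConj L) v) (cmLocalForm L 3 v))) * w₀⁻¹, weylConj_mem_cmTorus L v w₀ hw₀ (torusChart L v m)⟩ : ↥(cmBorelTriple L 3 v).M) : ℂˣ) : ℂ)‖) * (r * ‖classOrbitalIntegral mQv φ (ConjClasses.mk ((((torusChart L v m) : ↥(cmBorelTriple L 3 v).M) : ↥(unitaryGroupOfForm (conjLocal L (IsCMField.complexConj L) v) (cmLocalForm L 3 v))) : Gqs L v))‖) :=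
      mul_le_mul_of_nonneg_right (le_add_of_nonneg_right hb) (mul_nonneg hpos.le hq)
    have hfin : ‖(((χ (torusChart L v m)) : ℂˣ) : ℂ)‖ * (r * ‖classOrbitalIntegral mQv φ (ConjClasses.mk ((((torusChart L v m) : ↥(cmBorelTriple L 3 v).M) : ↥(unitaryGroupOfForm (conjLocal L (IsCMField.complexConj L) v) (cmLocalForm L 3 v))) : Gqs L v))‖) ≤
        2 * c₀.toReal * (‖classOrbitalIntegral mQv φ (ConjClasses.mk ((((torusChart L v m) : ↥(cmBorelTriple L 3 v).M) : ↥(unitaryGroupOfForm (conjLocal L (IsCMField.complexConj L) v) (cmLocalForm L 3 v))) : Gqs L v))‖ * (((2 * c₀.toReal)⁻¹ * r ^ 2) * (r⁻¹ * (‖(((χ (torusChart L v m)) : ℂˣ) : ℂ)‖ + ‖((χ (⟨w₀ * ((torusChart L v m) : ↥(unitaryGroupOfForm (conjLocal L (IsCMField.complexConj L) v) (cmLocalForm L 3 v))) * w₀⁻¹, weylConj_mem_cmTorus L v w₀ hw₀ (torusChart L v m)⟩ : ↥(cmBorelTriple L 3 v).M) : ℂˣ) : ℂ)‖)))) := by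
      calc ‖(((χ (torusChart L v m)) : ℂˣ) : ℂ)‖ * (r * ‖classOrbitalIntegral mQv φ (ConjClasses.mk ((((torusChart L v m) : ↥(cmBorelTriple L 3 v).M) : ↥(unitaryGroupOfForm (conjLocal L (IsCMField.complexConj L) v) (cmLocalForm L 3 v))) : Gqs L v))‖) ≤ (‖(((χ (torusChart L v m)) : ℂˣ) : ℂ)‖ + ‖((χ (⟨w₀ * ((torusChart L v m) : ↥(unitaryGroupOfForm (conjLocal L (IsCMField.complexConj L) v) (cmLocalForm L 3 v))) * w₀⁻¹, weylConj_mem_cmTorus L v w₀ hw₀ (torusChart L v m)⟩ : ↥(cmBorelTriple L 3 v).M) : ℂˣ) : ℂ)‖) * (r * ‖classOrbitalIntegral mQv φ (ConjClasses.mk ((((torusChart L v m) : ↥(cmBorelTriple L 3 v).M) : ↥(unitaryGroupOfForm (conjLocal L (IsCMField.complexConj L) v) (cmLocalForm L 3 v))) : Gqs L v))‖) := key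
        _ = 2 * c₀.toReal * (‖classOrbitalIntegral mQv φ (ConjClasses.mk ((((torusChart L v m) : ↥(cmBorelTriple L 3 v).M) : ↥(unitaryGroupOfForm (conjLocal L (IsCMField.complexConj L) v) (cmLocalForm L 3 v))) : Gqs L v))‖ * (((2 * c₀.toReal)⁻¹ * r ^ 2) * (r⁻¹ * (‖(((χ (torusChart L v m)) : ℂˣ) : ℂ)‖ + ‖((χ (⟨w₀ * ((torusChart L v m) : ↥(unitaryGroupOfForm (conjLocal L (IsCMField.complexConj L) v) (cmLocalForm L 3 v))) * w₀⁻¹, weylConj_mem_cmTorus L v w₀ hw₀ (torusChart L v m)⟩ : ↥(cmBorelTriple L 3 v).M) : ℂˣ) : ℂ)‖)))) := by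
          field_simp
    simpa only [norm_mul, Complex.norm_real, Real.norm_of_nonneg hpos.le, Real.norm_of_nonneg h1, Real.norm_of_nonneg h2,
      Real.norm_of_nonneg h3] using hfin
  -- (6) the torus-side integrand `F = χ(ι m)·Δ·O` is integrable: measurable through `hI₁`, dominated through `hI₂`
  have hιm : Measurable (torusChart L v) := (continuous_torusChart L v).measurable
  have hFint : Integrable (fun m : ((LocalRing L v)ˣ × ↥(normOneUnits (conjLocal L (IsCMField.complexConj L) v))) => (((χ (torusChart L v m)) : ℂˣ) : ℂ) * (vanDijkWeight L v (torusChart L v m) * classOrbitalIntegral mQv φ (ConjClasses.mk ((((torusChart L v m) : ↥(cmBorelTriple L 3 v).M) : ↥(unitaryGroupOfForm (conjLocal L (IsCMField.complexConj L) v) (cmLocalForm L 3 v))) : Gqs L v)))) μM := by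
    refine Integrable.mono' ((hI₂.norm).const_mul (2 * c₀.toReal)) ?_ ?_
    · have hpre : Measurable fun m : ((LocalRing L v)ˣ × ↥(normOneUnits (conjLocal L (IsCMField.complexConj L) v))) => (((χ (torusChart L v m)) : ℂˣ) : ℂ) * vanDijkWeight L v (torusChart L v m) * ((((2 * c₀.toReal)⁻¹ * ((vanDijkWeight L v (torusChart L v m)).re ^ 2 : ℝ) : ℝ) : ℂ))⁻¹ :=
        (((hχ.comp (continuous_torusChart L v)).measurable.mul
          ((F0P3cStCharTSVanDijkCore.continuous_vanDijkWeight L v hns).comp (continuous_torusChart L v)).measurable).mul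
          (Complex.measurable_ofReal.comp (measurable_const.mul (((Complex.measurable_re.comp
            (F0P3cStCharTSVanDijkCore.measurable_vanDijkWeight L v hns)).pow_const 2).comp hιm))).inv)
      refine (hpre.aestronglyMeasurable.mul hI₁.aestronglyMeasurable).congr ?_
      filter_upwards [hreg] with m hm
      obtain ⟨hmreg, hpos⟩ := hm
      have hρ : (((2 * c₀.toReal)⁻¹ * ((vanDijkWeight L v (torusChart L v m)).re ^ 2 : ℝ) : ℝ) : ℂ) ≠ 0 :=
        Complex.ofReal_ne_zero.2 (mul_pos (inv_pos.2 (by positivity)) (pow_pos hpos 2)).ne'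
      simp only [Pi.mul_apply]
      rw [hO' m hmreg, mul_one]
      calc (((χ (torusChart L v m)) : ℂˣ) : ℂ) * vanDijkWeight L v (torusChart L v m) * ((((2 * c₀.toReal)⁻¹ * ((vanDijkWeight L v (torusChart L v m)).re ^ 2 : ℝ) : ℝ) : ℂ))⁻¹ * (classOrbitalIntegral mQv φ (ConjClasses.mk ((((torusChart L v m) : ↥(cmBorelTriple L 3 v).M) : ↥(unitaryGroupOfForm (conjLocal L (IsCMField.complexConj L) v) (cmLocalForm L 3 v))) : Gqs L v)) * (((2 * c₀.toReal)⁻¹ * ((vanDijkWeight L v (torusChart L v m)).re ^ 2 : ℝ) : ℝ) : ℂ))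
          = (((χ (torusChart L v m)) : ℂˣ) : ℂ) * (vanDijkWeight L v (torusChart L v m) * classOrbitalIntegral mQv φ (ConjClasses.mk ((((torusChart L v m) : ↥(cmBorelTriple L 3 v).M) : ↥(unitaryGroupOfForm (conjLocal L (IsCMField.complexConj L) v) (cmLocalForm L 3 v))) : Gqs L v))) * (((((2 * c₀.toReal)⁻¹ * ((vanDijkWeight L v (torusChart L v m)).re ^ 2 : ℝ) : ℝ) : ℂ))⁻¹ * (((2 * c₀.toReal)⁻¹ * ((vanDijkWeight L v (torusChart L v m)).re ^ 2 : ℝ) : ℝ) : ℂ)) := by ring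
        _ = (((χ (torusChart L v m)) : ℂˣ) : ℂ) * (vanDijkWeight L v (torusChart L v m) * classOrbitalIntegral mQv φ (ConjClasses.mk ((((torusChart L v m) : ↥(cmBorelTriple L 3 v).M) : ↥(unitaryGroupOfForm (conjLocal L (IsCMField.complexConj L) v) (cmLocalForm L 3 v))) : Gqs L v))) := by rw [inv_mul_cancel₀ hρ, mul_one]
    · filter_upwards [hreg] with m hm
      exact hnormS m hm.1 hm.2
  -- (7) `W`-symmetrisation: `∫ ψ(ι m)·Δ·O dμM = 2 ∫ χ(ι m)·Δ·O dμM`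
  have hFω : Integrable (fun m : ((LocalRing L v)ˣ × ↥(normOneUnits (conjLocal L (IsCMField.complexConj L) v))) => (((χ (torusChart L v ((Units.map ((conjLocal L (IsCMField.complexConj L) v : LocalRing L v →+* LocalRing L v) : LocalRing L v →* LocalRing L v) m.1)⁻¹, m.2))) : ℂˣ) : ℂ) * (vanDijkWeight L v (torusChart L v m) * classOrbitalIntegral mQv φ (ConjClasses.mk ((((torusChart L v m) : ↥(cmBorelTriple L 3 v).M) : ↥(unitaryGroupOfForm (conjLocal L (IsCMField.complexConj L) v) (cmLocalForm L 3 v))) : Gqs L v)))) μM := by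
    have h := ((F0P3cStCharTSTorusRay.measurePreserving_reflect L v μM).integrable_comp_emb (F0P3cStCharTSTorusRay.measurableEmbedding_reflect L v)).2 hFint
    refine h.congr (Eventually.of_forall fun m => ?_)
    simp only [Function.comp_apply]
    rw [hG m]
  have hsub : ∫ m : ((LocalRing L v)ˣ × ↥(normOneUnits (conjLocal L (IsCMField.complexConj L) v))), (((χ (torusChart L v ((Units.map ((conjLocal L (IsCMField.complexConj L) v : LocalRing L v →+* LocalRing L v) : LocalRing L v →* LocalRing L v) m.1)⁻¹, m.2))) : ℂˣ) : ℂ) * (vanDijkWeight L v (torusChart L v m) * classOrbitalIntegral mQv φ (ConjClasses.mk ((((torusChart L v m) : ↥(cmBorelTriple L 3 v).M) : ↥(unitaryGroupOfForm (conjLocal L (IsCMField.complexConj L) v) (cmLocalForm L 3 v))) : Gqs L v))) ∂μM =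
      ∫ m : ((LocalRing L v)ˣ × ↥(normOneUnits (conjLocal L (IsCMField.complexConj L) v))), (((χ (torusChart L v m)) : ℂˣ) : ℂ) * (vanDijkWeight L v (torusChart L v m) * classOrbitalIntegral mQv φ (ConjClasses.mk ((((torusChart L v m) : ↥(cmBorelTriple L 3 v).M) : ↥(unitaryGroupOfForm (conjLocal L (IsCMField.complexConj L) v) (cmLocalForm L 3 v))) : Gqs L v))) ∂μM := by
    have hint := (F0P3cStCharTSTorusRay.measurePreserving_reflect L v μM).integral_comp (F0P3cStCharTSTorusRay.measurableEmbedding_reflect L v)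
      (fun m : ((LocalRing L v)ˣ × ↥(normOneUnits (conjLocal L (IsCMField.complexConj L) v))) => (((χ (torusChart L v m)) : ℂˣ) : ℂ) * (vanDijkWeight L v (torusChart L v m) * classOrbitalIntegral mQv φ (ConjClasses.mk ((((torusChart L v m) : ↥(cmBorelTriple L 3 v).M) : ↥(unitaryGroupOfForm (conjLocal L (IsCMField.complexConj L) v) (cmLocalForm L 3 v))) : Gqs L v))))
    rw [← hint]
    refine integral_congr_ae (Eventually.of_forall fun m => ?_)
    simp only
    rw [hG m]
  have hψint : ∫ m : ((LocalRing L v)ˣ × ↥(normOneUnits (conjLocal L (IsCMField.complexConj L) v))), ψ (torusChart L v m) * (vanDijkWeight L v (torusChart L v m) * classOrbitalIntegral mQv φ (ConjClasses.mk ((((torusChart L v m) : ↥(cmBorelTriple L 3 v).M) : ↥(unitaryGroupOfForm (conjLocal L (IsCMField.complexConj L) v) (cmLocalForm L 3 v))) : Gqs L v))) ∂μM =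
      2 * ∫ m : ((LocalRing L v)ˣ × ↥(normOneUnits (conjLocal L (IsCMField.complexConj L) v))), (((χ (torusChart L v m)) : ℂˣ) : ℂ) * (vanDijkWeight L v (torusChart L v m) * classOrbitalIntegral mQv φ (ConjClasses.mk ((((torusChart L v m) : ↥(cmBorelTriple L 3 v).M) : ↥(unitaryGroupOfForm (conjLocal L (IsCMField.complexConj L) v) (cmLocalForm L 3 v))) : Gqs L v))) ∂μM := by
    have hsum : (fun m : ((LocalRing L v)ˣ × ↥(normOneUnits (conjLocal L (IsCMField.complexConj L) v))) => ψ (torusChart L v m) * (vanDijkWeight L v (torusChart L v m) * classOrbitalIntegral mQv φ (ConjClasses.mk ((((torusChart L v m) : ↥(cmBorelTriple L 3 v).M) : ↥(unitaryGroupOfForm (conjLocal L (IsCMField.complexConj L) v) (cmLocalForm L 3 v))) : Gqs L v)))) =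
        fun m : ((LocalRing L v)ˣ × ↥(normOneUnits (conjLocal L (IsCMField.complexConj L) v))) => (((χ (torusChart L v m)) : ℂˣ) : ℂ) * (vanDijkWeight L v (torusChart L v m) * classOrbitalIntegral mQv φ (ConjClasses.mk ((((torusChart L v m) : ↥(cmBorelTriple L 3 v).M) : ↥(unitaryGroupOfForm (conjLocal L (IsCMField.complexConj L) v) (cmLocalForm L 3 v))) : Gqs L v))) + (((χ (torusChart L v ((Units.map ((conjLocal L (IsCMField.complexConj L) v : LocalRing L v →+* LocalRing L v) : LocalRing L v →* LocalRing L v) m.1)⁻¹, m.2))) : ℂˣ) : ℂ) * (vanDijkWeight L v (torusChart L v m) * classOrbitalIntegral mQv φ (ConjClasses.mk ((((torusChart L v m) : ↥(cmBorelTriple L 3 v).M) : ↥(unitaryGroupOfForm (conjLocal L (IsCMField.complexConj L) v) (cmLocalForm L 3 v))) : Gqs L v))) := by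
      funext m
      rw [hψ, hχω m, add_mul]
    rw [hsum, integral_add hFint hFω, hsub, two_mul]
  -- (8) assembly
  rw [h1]
  have hR1 : ∫ g, φ g * (((c₀.toReal * cT⁻¹ : ℝ) : ℂ) * α g) ∂νQv = ((c₀.toReal * cT⁻¹ : ℝ) : ℂ) * ∫ g, φ' g * α g ∂νQv := by
    rw [← integral_const_mul]
    refine integral_congr_ae (Eventually.of_forall fun g => ?_)
    simp only
    by_cases hg : g ∈ hyperbolicSet L v
    · rw [hφ'Ω g hg]; ring
    · rw [hα0 g hg]; simp
  have hR2 : ∫ m : ((LocalRing L v)ˣ × ↥(normOneUnits (conjLocal L (IsCMField.complexConj L) v))), classOrbitalIntegral mQv φ' (ConjClasses.mk ((((torusChart L v m) : ↥(cmBorelTriple L 3 v).M) : ↥(unitaryGroupOfForm (conjLocal L (IsCMField.complexConj L) v) (cmLocalForm L 3 v))) : Gqs L v)) * ((((2 * c₀.toReal)⁻¹ * ((vanDijkWeight L v (torusChart L v m)).re ^ 2 : ℝ) : ℝ) : ℂ) * α ((((torusChart L v m) : ↥(cmBorelTriple L 3 v).M) : ↥(unitaryGroupOfForm (conjLocal L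 (IsCMField.complexConj L) v) (cmLocalForm L 3 v))) : Gqs L v)) ∂μM =
      (((2 * c₀.toReal)⁻¹ : ℝ) : ℂ) * ∫ m : ((LocalRing L v)ˣ × ↥(normOneUnits (conjLocal L (IsCMField.complexConj L) v))), ψ (torusChart L v m) * (vanDijkWeight L v (torusChart L v m) * classOrbitalIntegral mQv φ (ConjClasses.mk ((((torusChart L v m) : ↥(cmBorelTriple L 3 v).M) : ↥(unitaryGroupOfForm (conjLocal L (IsCMField.complexConj L) v) (cmLocalForm L 3 v))) : Gqs L v))) ∂μM := by
    rw [← integral_const_mul]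
    refine integral_congr_ae ?_
    filter_upwards [hreg] with m hm
    exact hρval m hm.1 hm.2
  rw [hR1, hW, hR2, hψint]
  have hcT' : ((c₀.toReal * cT⁻¹ : ℝ) : ℂ) * ((((2 * c₀.toReal)⁻¹ : ℝ) : ℂ) * (2 * ∫ m : ((LocalRing L v)ˣ × ↥(normOneUnits (conjLocal L (IsCMField.complexConj L) v))), (((χ (torusChart L v m)) : ℂˣ) : ℂ) * (vanDijkWeight L v (torusChart L v m) * classOrbitalIntegral mQv φ (ConjClasses.mk ((((torusChart L v m) : ↥(cmBorelTriple L 3 v).M) : ↥(unitaryGroupOfForm (conjLocal L (IsCMField.complexConj L) v) (cmLocalForm L 3 v))) : Gqs L v))) ∂μM)) =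
      (((cT⁻¹ : ℝ)) : ℂ) * ∫ m : ((LocalRing L v)ˣ × ↥(normOneUnits (conjLocal L (IsCMField.complexConj L) v))), (((χ (torusChart L v m)) : ℂˣ) : ℂ) * (vanDijkWeight L v (torusChart L v m) * classOrbitalIntegral mQv φ (ConjClasses.mk ((((torusChart L v m) : ↥(cmBorelTriple L 3 v).M) : ↥(unitaryGroupOfForm (conjLocal L (IsCMField.complexConj L) v) (cmLocalForm L 3 v))) : Gqs L v))) ∂μM := by
    have h2c : ((c₀.toReal : ℝ) : ℂ) ≠ 0 := Complex.ofReal_ne_zero.2 hc₀r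
    push_cast
    field_simp
  rw [hcT']


/-! ## §5 The ROW-11 SHAPE for the classes realised by a principal series -/

/-- **SOCKET #11 `sig_K2E3CharLocIntNearSemisimple` FOR THE PRINCIPAL-SERIES CLASSES OF `U(Φ₃)(L⁺_v)`, `v` NON-SPLIT — TOKEN FOR TOKEN** (at `N = 3`, `H = Φ₃`):
for every class `c = ⟦r⟧` whose representative is EQUIVALENT to some `i_G(χ)` (`χ` continuous; e.g. every irreducible `i_G(χ)`, ★
`isIrreducible_cmPrincipalSeries_of_cmWeylTorusCharPair_ne`), at EVERY `s` (semisimple or not) there are an open `U ∋ s` and `Θ` integrable on `U` with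
`χ_c(f) = ∫ f·Θ dμ` for all test functions supported in `U` — from §4 (`U` = the interior of a compact neighbourhood, `Θ` the global `L¹_loc` character; equivalent
representations have the same character, ★ `Representation.smoothTrace_eq_of_equiv`). [cite: Rogawski1990, §4.9 (4.9.4) p. 56; §12.5 p. 182]
[cite: HarishChandra1999, Thm. 16.1 p. 77] [cite: vanDijk1972, Thm. p. 237] -/
theorem charLocIntNearSemisimple_of_equiv_cmPrincipalSeries
    (hns : ∀ w : PlacesOver L v, IsCMField.complexConj L • w.1 = w.1)
    [MeasurableSpace (Gqs L v)] [BorelSpace (Gqs L v)] (μ : Measure (Gqs L v)) [μ.IsHaarMeasure]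
    (χ : ↥(cmBorelTriple L 3 v).M →* ℂˣ) (hχ : Continuous fun t => ((χ t : ℂˣ) : ℂ))
    (c : IrrClass (Gqs L v)) (r : SmoothIrrep (Gqs L v)) (hr : IrrClass.mk r = c)
    (e : r.ρ.Equiv (UnitaryGroup.cmPrincipalSeries L 3 v χ)) :
    ∀ s : Gqs L v,
      Module.End.IsSemisimple (Matrix.toLin' ((s.val : GL (Fin 3) (UnitaryGroup.LocalRing L v)).val : Matrix (Fin 3) (Fin 3) (UnitaryGroup.LocalRing L v))) →
        ∃ U : Set (Gqs L v), IsOpen U ∧ s ∈ U ∧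
          ∃ Θ : Gqs L v → ℂ, IntegrableOn Θ U μ ∧
            ∀ f : Gqs L v → ℂ, f ∈ SchwartzBruhat (Gqs L v) → tsupport f ⊆ U →
              c.smoothTrace μ f = ∫ g, f g * Θ g ∂μ := by
  intro s _
  haveI : LocallyCompactSpace (Gqs L v) := locallyCompactSpace_local (IsCMField.complexConj L) 3 _ v
  obtain ⟨Θ, hΘ, htr⟩ := exists_locallyIntegrable_smoothTrace_cmPrincipalSeries_eq L v hns μ χ hχ
  obtain ⟨K, hK, hKs⟩ := exists_compact_mem_nhds s
  refine ⟨interior K, isOpen_interior, mem_interior_iff_mem_nhds.2 hKs, Θ, (hΘ.integrableOn_isCompact hK).mono_set interior_subset,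
    fun f hf _ => ?_⟩
  subst hr
  rw [IrrClass.smoothTrace_mk]
  have he := congrFun (Representation.smoothTrace_eq_of_equiv r.ρ μ e) f
  rw [← he]
  exact htr f hf.1 hf.2

end Summit.HodgeConjecture.HodgeConjecture.Cruxes.H413.K2E3CharLocIntPrincipalSeriesThree

end
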